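import Mathlib.AlgebraicGeometry.Morphisms.Etale
import Mathlib.RingTheory.Etale.Locus
import Mathlib.RingTheory.Smooth.Fiber
import HarnessLib

/-!
# Flat and unramified at a point ⇒ étale on a neighbourhood (EGA IV₄ 17.6.1 c)⇒a))

Topic: `Literature/AlgebraicGeometry/Resolution`. EGA IV₄, Théorème 17.6.1: for `f : X → Y`
locally of finite presentation, `x ∈ X`, `y = f(x)`, "les conditions suivantes sont
équivalentes : a) `f` est étale au point `x` [i.e. on an open neighbourhood of `x`] … c) `f` est
plat au point `x` et non ramifié au point `x`." This file PROVES c)⇒a) for Mathlib's `Etale`,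
with "flat / unramified at `x`" read on the stalk map `𝒪_{Y,y} → 𝒪_{X,x}`
(`RingHom.Flat`, `RingHom.FormallyUnramified`):

* `isEtaleAt_of_flat_of_formallyUnramified_localization` — the local algebra: for `S` of finite
  presentation over `R` and a prime `𝔮` over `𝔭`, if `S_𝔮` is flat and formally unramified over
  `R_𝔭` then `S` is étale at `𝔮` (Mathlib `Algebra.IsEtaleAt`). The fibre `κ(𝔭) ⊗ S_𝔮` is formally
  unramified over the field `κ(𝔭)`, hence formally étale (Mathlib
  `Algebra.FormallyEtale.of_formallyUnramified_of_field`), so `S_𝔮` is formally smooth over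
  `R_𝔭` by the fibrewise criterion (Mathlib `Algebra.FormallySmooth.of_formallySmooth_residueField_tensor`,
  which only needs flatness of `S_𝔮`), and the étale locus is `unramified ∩ smooth`.
* `localRingHom_of_stalkMap` — transfer of iso-invariant ring-hom properties from the stalk map
  to the localised chart map (Mathlib `IsAffineOpen.arrowStalkMapIso`).
* `exists_etale_ι_comp_of_flat_of_formallyUnramified_stalkMap` — **c)⇒a)**: if `g : H → Y` is
  locally of finite presentation and `g^♯_z : 𝒪_{Y,g z} → 𝒪_{H,z}` is flat and formally
  unramified, there is an open `O ∋ z` with `Etale (O.ι ≫ g)` (the étale locus of the chart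
  algebra is open, Mathlib `Algebra.isOpen_etaleLocus`; a basic open `D(s) ∋ z` inside it is
  étale over the affine chart of `Y`).

Used for de Jong 1996, proof of Lemma 4.13 ("`f|_H : H → Y` is finite étale over a
neighbourhood of `y`", the named fact `DeJong1996MultisectionEtaleNhd`), together with the
spreading step `exists_etale_morphismRestrict_of_forall_exists_opens` (`EtaleOverNhd.lean`).
Mathlib searched (pin v4.32): `Algebra.IsEtaleAt.of_isUnramifiedAt_of_flat` and
`Algebra.IsSmoothAt.of_formallySmooth_fiber` need GLOBAL flatness `Module.Flat R S`; no
scheme-level étale/unramified locus.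

## Sources

* A. Grothendieck, J. Dieudonné, *EGA IV₄*, Publ. Math. IHÉS 32 (1967), Thm. 17.6.1 (p. 70 of the
  volume: "c) `f` est plat au point `x` et non ramifié au point `x`"). [Grothendieck1967]
* The Stacks Project, Tag 08WD, Tag 00TF. [StacksProject]
-/

noncomputable section

open CategoryTheory CategoryTheory.Limits AlgebraicGeometry TopologicalSpace Topology IsLocalRing
  TensorProduct

namespace Literature.AlgebraicGeometry.Resolution

universe u

/-- **Local algebra of EGA IV₄ 17.6.1 c)⇒a).** Let `R → S` be of finite presentation, `𝔮 ⊂ S` a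
prime over `𝔭 ⊂ R`. If `S_𝔮` is flat and formally unramified over `R_𝔭`, then `S` is étale at `𝔮`
(`Algebra.IsEtaleAt R 𝔮`): `κ(𝔭) ⊗ S_𝔮` is formally unramified and essentially of finite type over
the field `κ(𝔭)`, hence formally étale, hence formally smooth, so `S_𝔮` is formally smooth over
`R_𝔭` by the fibrewise criterion (Mathlib `Algebra.FormallySmooth.of_formallySmooth_residueField_tensor`,
`S_𝔮` being a localisation of the finitely presented `R_𝔭`-algebra `S_𝔭`), hence over `R`; and it
is formally unramified over `R`. [cite: Grothendieck1967, Thm. 17.6.1 c)⇒a)] -/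
theorem isEtaleAt_of_flat_of_formallyUnramified_localization {R S : Type u} [CommRing R]
    [CommRing S] [Algebra R S] [Algebra.FinitePresentation R S] (p : Ideal R) (q : Ideal S)
    [p.IsPrime] [q.IsPrime] [q.LiesOver p]
    (hfl : letI := Localization.AtPrime.algebraOfLiesOver p q
      Module.Flat (Localization.AtPrime p) (Localization.AtPrime q))
    (hur : letI := Localization.AtPrime.algebraOfLiesOver p q
      Algebra.FormallyUnramified (Localization.AtPrime p) (Localization.AtPrime q)) :
    Algebra.IsEtaleAt R q := by
  let Rp := Localization.AtPrime p
  let Sp := Localization (Algebra.algebraMapSubmonoid S p.primeCompl)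
  let Sq := Localization.AtPrime q
  letI := Localization.AtPrime.algebraOfLiesOver p q
  -- unramified at `q`
  haveI hur' : Algebra.FormallyUnramified Rp Sq := hur
  haveI hfl' : Module.Flat Rp Sq := hfl
  have hU : Algebra.IsUnramifiedAt R q := Algebra.FormallyUnramified.comp R Rp Sq
  -- the fibre `κ(p) ⊗ S_q` is formally smooth over `κ(p)`
  haveI : Algebra.EssFiniteType Rp Sq := .of_comp R _ _
  haveI : Algebra.FormallySmooth (ResidueField Rp) (ResidueField Rp ⊗[Rp] Sq) := by
    haveI : Algebra.FormallyUnramified (ResidueField Rp) (ResidueField Rp ⊗[Rp] Sq) :=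
      inferInstance
    haveI : Algebra.EssFiniteType (ResidueField Rp) (ResidueField Rp ⊗[Rp] Sq) := inferInstance
    haveI : Algebra.FormallyEtale (ResidueField Rp) (ResidueField Rp ⊗[Rp] Sq) :=
      .of_formallyUnramified_of_field _ _
    infer_instance
  -- `S_q` is a localization of the finitely presented `R_p`-algebra `S_p`
  let f : Sp →ₐ[S] Sq := IsLocalization.liftAlgHom
      (M := Algebra.algebraMapSubmonoid S p.primeCompl) (f := Algebra.ofId _ _) (by
    rintro ⟨_, x, hx, rfl⟩
    simpa using! IsLocalization.map_units (M := q.primeCompl) Sq ⟨algebraMap _ _ x,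
      by simp_all [q.over_def p]⟩)
  algebraize [f.toRingHom]
  have : IsScalarTower R Sp Sq := .to₁₃₄ _ S _ _
  have : IsScalarTower Rp Sp Sq := .of_algebraMap_eq' <| by
    apply IsLocalization.ringHom_ext p.primeCompl
    simp only [RingHom.comp_assoc, ← IsScalarTower.algebraMap_eq]
  have : IsLocalization (Algebra.algebraMapSubmonoid Sp q.primeCompl) Sq :=
    .isLocalization_of_submonoid_le _ _ (Algebra.algebraMapSubmonoid S p.primeCompl) _
    (by rintro _ ⟨x, hx, rfl⟩; simp_all [q.over_def p])
  have : Algebra.FinitePresentation Rp Sp := by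
    have : Algebra.IsPushout R Rp S Sp :=
      .symm <| Algebra.isPushout_of_isLocalization p.primeCompl _ _ _
    exact .equiv (Algebra.IsPushout.equiv R Rp S Sp)
  have hS : Algebra.FormallySmooth Rp Sq :=
    Algebra.FormallySmooth.of_formallySmooth_residueField_tensor
      (R := Rp) (S := Sq) (P := Sp) (Algebra.algebraMapSubmonoid _ q.primeCompl)
  have hS' : Algebra.IsSmoothAt R q := Algebra.FormallySmooth.comp R Rp Sq
  change (⟨q, inferInstance⟩ : PrimeSpectrum S) ∈ Algebra.etaleLocus R S
  rw [Algebra.etaleLocus_eq_unramfiedLocus_inter_smoothLocus]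
  exact ⟨hU, hS'⟩


/-- Transfer of the stalk hypotheses to the chart: for affine opens `z ∈ V ⊆ g⁻¹U`, the stalk
map `g^♯_z` is the localisation `Γ(Y,U)_𝔭 → Γ(H,V)_𝔮` of `g^♯ : Γ(Y,U) → Γ(H,V)` at the primes of
`g z` and `z` (Mathlib `IsAffineOpen.arrowStalkMapIso`), so ring-hom properties invariant under
isomorphisms of arrows pass from the former to the latter. [folklore] -/
theorem localRingHom_of_stalkMap {H Y : Scheme.{u}} (g : H ⟶ Y) {U : Y.Opens}
    (hU : IsAffineOpen U) {V : H.Opens} (hV : IsAffineOpen V) (hVU : V ≤ g ⁻¹ᵁ U) {z : H}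
    (hz : z ∈ V) {Q : ∀ {A B : Type u} [CommRing A] [CommRing B], (A →+* B) → Prop}
    (hQ : RingHom.RespectsIso Q) (h : Q (g.stalkMap z).hom) :
    Q (Localization.localRingHom _ _ (g.appLE U V hVU).hom
        congr($(IsAffineOpen.comap_primeIdealOf_appLE U hU V hV hVU hz).1).symm) := by
  have := (hQ.arrow_mk_iso_iff (IsAffineOpen.arrowStalkMapIso g U hU V hV hVU hz)).mp h
  exact this

set_option backward.defeqAttrib.useBackward true in
set_option backward.isDefEq.respectTransparency false in
/-- **EGA IV₄ 17.6.1 c)⇒a) (flat and unramified at a point ⇒ étale near the point).** Let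
`g : H → Y` be locally of finite presentation and `z ∈ H`. If the stalk map
`𝒪_{Y, g z} → 𝒪_{H, z}` is flat and formally unramified, then `g` is étale on an open
neighbourhood `O` of `z` (`Etale (O.ι ≫ g)`): on affine charts `z ∈ V = Spec S ⊆ g⁻¹U`,
`U = Spec R`, the prime `𝔮` of `z` lies in the étale locus of `S/R`
(`isEtaleAt_of_flat_of_formallyUnramified_localization`), which is open (Mathlib
`Algebra.isOpen_etaleLocus`), so some basic open `D(s) ∋ z` is étale over `U`.
[cite: Grothendieck1967, Thm. 17.6.1 c)⇒a)] -/
theorem exists_etale_ι_comp_of_flat_of_formallyUnramified_stalkMap {H Y : Scheme.{u}}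
    (g : H ⟶ Y) [LocallyOfFinitePresentation g] (z : H) (hfl : (g.stalkMap z).hom.Flat)
    (hur : (g.stalkMap z).hom.FormallyUnramified) :
    ∃ O : H.Opens, z ∈ O ∧ Etale (O.ι ≫ g) := by
  obtain ⟨_, ⟨U, hU, rfl⟩, hzU, -⟩ :=
    Y.isBasis_affineOpens.exists_subset_of_mem_open (Set.mem_univ (g z)) isOpen_univ
  obtain ⟨_, ⟨V, hV, rfl⟩, hzV, hVU⟩ :=
    H.isBasis_affineOpens.exists_subset_of_mem_open hzU (U.2.preimage g.continuous)
  have := g.finitePresentation_appLE hU hV hVU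
  algebraize [(g.appLE U V hVU).hom]
  let p := hU.primeIdealOf ⟨g z, hVU hzV⟩
  let q := hV.primeIdealOf ⟨z, hzV⟩
  haveI : q.asIdeal.LiesOver p.asIdeal :=
    ⟨congr($(IsAffineOpen.comap_primeIdealOf_appLE U hU V hV hVU hzV).1).symm⟩
  letI := Localization.AtPrime.algebraOfLiesOver p.asIdeal q.asIdeal
  -- the stalk map is `R_𝔭 → S_𝔮`
  have hfl' : Module.Flat (Localization.AtPrime p.asIdeal) (Localization.AtPrime q.asIdeal) :=
    localRingHom_of_stalkMap g hU hV hVU hzV RingHom.Flat.respectsIso hfl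
  have hur' : Algebra.FormallyUnramified (Localization.AtPrime p.asIdeal)
      (Localization.AtPrime q.asIdeal) := by
    have := localRingHom_of_stalkMap g hU hV hVU hzV RingHom.FormallyUnramified.respectsIso hur
    exact this
  haveI : Algebra.IsEtaleAt Γ(Y, U) q.asIdeal :=
    isEtaleAt_of_flat_of_formallyUnramified_localization p.asIdeal q.asIdeal hfl' hur'
  -- a basic open `D(s) ∋ z` étale over `U`
  obtain ⟨s, hsq, hs⟩ := Algebra.exists_etale_of_isEtaleAt (R := Γ(Y, U)) q.asIdeal
  have hzs : z ∈ H.basicOpen s := by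
    change s ∉ (hV.primeIdealOf ⟨z, hzV⟩).asIdeal at hsq
    rwa [← PrimeSpectrum.mem_basicOpen, IsAffineOpen.primeIdealOf,
      ← hV.fromSpec_preimage_basicOpen, Scheme.Hom.mem_preimage, ← Scheme.Hom.comp_apply,
      IsAffineOpen.isoSpec_hom, IsAffineOpen.toSpecΓ_fromSpec] at hsq
  have hsU : H.basicOpen s ≤ g ⁻¹ᵁ U := (H.basicOpen_le s).trans hVU
  have hQ : (g.appLE U (H.basicOpen s) hsU).hom.Etale := by
    have := hV.isLocalization_basicOpen s
    have hs' : (algebraMap Γ(Y, U) (Localization.Away s)).Etale := by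
      rw [RingHom.etale_algebraMap]
      exact hs
    convert!
      RingHom.Etale.propertyIsLocal.respectsIso.1 _
        (IsLocalization.algEquiv (.powers s) _ Γ(H, H.basicOpen s)).toRingEquiv hs'
    ext
    dsimp
    simp only [IsScalarTower.algebraMap_apply Γ(Y, U) Γ(H, V) (Localization _),
      IsLocalization.map_eq]
    simp only [RingHom.algebraMap_toAlgebra, RingHomCompTriple.comp_apply, ← ConcreteCategory.comp_apply,
      Scheme.Hom.appLE_map]
  refine ⟨H.basicOpen s, hzs, ?_⟩
  have hres : Etale (g.resLE U (H.basicOpen s) hsU) := by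
    have : IsAffine _ := hU
    have : IsAffine _ := hV.basicOpen s
    rw [HasRingHomProperty.iff_of_isAffine (P := @Etale)]
    exact (RingHom.Etale.propertyIsLocal.respectsIso.arrow_mk_iso_iff
      (arrowResLEAppIso g U (H.basicOpen s) hsU)).mpr hQ
  rw [← Scheme.Hom.resLE_comp_ι g hsU]
  infer_instance

end Literature.AlgebraicGeometry.Resolution

end
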